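import Literature.MathematicalPhysics.QuantumFieldTheory.Balaban1983to89.T3AlphaInputsACTwoRunLevel
import Summits.QuantumFields.YangMills.Theorems.UnitScaleTiltFluctuationComparisonRegPrSocketLevelsAlpha
import HarnessLib

/-!
# Route `UnitScaleTilt` — crux K1bR-pr `FluctuationComparisonRegPr` (stmt-QuantumFields-19201), S-E″ bookkeeping, part 2: THE BUDGET ARITHMETIC
# (support file `--supports stmt-QuantumFields-19201`)

Fleet lead `ym-ust-19201-p2` (gen 2); FINDING-19201-SE2-scaling.  Pure arithmetic for the S-E″ rung (`PolymerCauchyAt D b₀ p₀ m` from the per-run clauses +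
`TwoRunLv` + `MinimiserCauchyAt`): with `k = K − n` steps above the comparison height `n`, a per-polymer budget of the shape
`M₀·e^{−κ₁𝓛(Y)}·L^{−4(k−i)}·(L^{−i})^{b}` at level `i` (`0 < b ≤ 1`) sums over the level-`i` localisation domains (`LocCover` + `LocBlockVolume`:
`Σ_{Y ∈ Loc_i} e^{−κ₁𝓛(Y)} ≤ 8C′·L^{3(m_F+K)}/L^{3i}`) to at most `8M₀C′L^{3m_F}·L^{3n − b·k}`, hence over the `k` levels to `k·8M₀C′L^{3m_F}·L^{3n−bk}`; the extra
finest slice of run `K+1` costs `8CC′Θ²L^{3m_F}·L^{3n−k}`; and along `n = ⌊K/m⌋` one has `3n − bk ≤ −(b − (3+b)/m)·K`, so everything is dominated by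
`M·(K+1)·rᴷ`, `r = L^{−(b−(3+b)/m)} < 1` once `m > (3+b)/b` — [King1986] (3.12)–(3.13) p.657 «γ′(m−1) > β» with `β = 3`.  No analysis; the only inputs are
the two counting schemas.

References: C. King, CMP 102 (1986) 649–677 [King1986] ((3.12)–(3.13) p.657); T. Bałaban, CMP 102 (1985) 255–275 [Balaban1985UV3] ((45)–(46) p.267).
-/

noncomputable section

open MeasureTheory Filter Topology
open Literature.MathematicalPhysics.QuantumFieldTheory.Balaban1983to89
open Literature.MathematicalPhysics.QuantumFieldTheory.Balaban1983to89.T3ContinuumYM3Torus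
open Literature.MathematicalPhysics.QuantumFieldTheory.Balaban1983to89.T3LevelShift
open Literature.MathematicalPhysics.QuantumFieldTheory.Balaban1983to89.T3AlphaInputsAC
open Literature.MathematicalPhysics.QuantumFieldTheory.Balaban1983to89.T3AlphaInputsACTwoRunLevel
open Literature.MathematicalPhysics.QuantumFieldTheory.Balaban1983to89.Missing
open Summit.QuantumFields.YangMills.Theorems.LogComparisonSocketLevelsAlpha (sum_loc_exp_le_of_locCover_of_volume)

namespace Summit.QuantumFields.YangMills.Theorems.LogComparisonPolymerBudget

variable {F : T3Family} {γ : ℝ} (D : AlphaDataT3 F γ)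

/-! ## §1 Counting: the fine torus, and the sum of the printed decay over one level's localisation domains -/

/-- The number of sites of run `K`'s finest torus: `(2L^{m_F+K})³ = 8·L^{3(m_F+K)}`. [cite: Balaban1987RG1, (0.1) p.251] -/
theorem card_site_zero (F : T3Family) (K : ℕ) : (Fintype.card (Site (F.P K) 0) : ℝ) = 8 * (F.L : ℝ) ^ (3 * (F.m + K)) := by
  have h : Fintype.card (Site (F.P K) 0) = Fintype.card (Fin (F.P K).d → ZMod ((F.P K).sitesPerDir 0)) := rfl
  rw [h, Fintype.card_fun, ZMod.card, Fintype.card_fin, T3Family.P_d]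
  have hs : (F.P K).sitesPerDir 0 = 2 * F.L ^ (F.m + K) := by
    rw [T3Family.P_eq_PP, T3Family.sitesPerDir_PP, Nat.sub_zero]
  rw [hs]
  push_cast
  ring

/-- **THE LEVEL-`i` COUNT**: under `LocCover D κ₁ C′` and `LocBlockVolume D`, `Σ_{Y ∈ Loc K j h i} e^{−κ₁𝓛(Y)} ≤ max(C′,0)·8·L^{3(m_F+K)}/L^{3i}` — the number of
level-`i` blocks, (45)–(46) p.267. [cite: Balaban1985UV3, (45)-(46) p.267] -/
theorem sum_exp_le {κ₁ C' : ℝ} (hLC : LocCover D κ₁ C') (hBV : LocBlockVolume D) (K j : ℕ) (h : D.Hist K j) (i : ℕ) :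
    ∑ Y ∈ D.Loc K j h i, Real.exp (-κ₁ * D.treeLen K i Y) ≤ max C' 0 * 8 * (F.L : ℝ) ^ (3 * (F.m + K)) / (F.L : ℝ) ^ (3 * i) := by
  have hL0 : (0 : ℝ) < (F.L : ℝ) := by have := F.hL.2; exact_mod_cast (by omega : 0 < F.L)
  have hN : (0 : ℝ) < (F.L : ℝ) ^ (3 * i) := pow_pos hL0 _
  have h1 := sum_loc_exp_le_of_locCover_of_volume D hLC K j h i hN (hBV K j h i)
  rw [card_site_zero] at h1
  refine h1.trans ?_
  have hc : C' * (8 * (F.L : ℝ) ^ (3 * (F.m + K))) ≤ max C' 0 * (8 * (F.L : ℝ) ^ (3 * (F.m + K))) :=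
    mul_le_mul_of_nonneg_right (le_max_left _ _) (by positivity)
  rw [mul_assoc (max C' 0)]
  exact div_le_div_of_nonneg_right hc hN.le

/-! ## §2 Powers of `L` as real powers, and the level exponent -/

/-- `((L^n)⁻¹)^c = L^{−c·n}` as a real power (`0 < L`). [folklore] -/
theorem inv_pow_pow_eq_rpow {x : ℝ} (hx : 0 < x) (n c : ℕ) : ((x ^ n)⁻¹) ^ c = x ^ (-((c : ℝ) * n)) := by
  rw [Real.rpow_neg hx.le, mul_comm, Real.rpow_mul hx.le, Real.rpow_natCast, Real.rpow_natCast, inv_pow]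

/-- `((L^n)⁻¹)^a = L^{−a·n}` for a real exponent `a` (`0 < L`). [folklore] -/
theorem inv_pow_rpow_eq_rpow {x : ℝ} (hx : 0 < x) (n : ℕ) (a : ℝ) : ((x ^ n)⁻¹) ^ a = x ^ (-(a * n)) := by
  rw [Real.rpow_neg hx.le, mul_comm, Real.rpow_mul hx.le, Real.rpow_natCast, Real.inv_rpow (pow_nonneg hx.le n)]

/-- **THE LEVEL EXPONENT**: for `i ≤ k`, `b ≤ 1`, `K = n + k`,
`L^{3(m_F+K)}·((L^{k−i})⁻¹)^4·((L^{i})⁻¹)^b / L^{3i} ≤ L^{3m_F}·L^{3n − b·k}` (`1 ≤ L`; the slack is `L^{−(1−b)(k−i)} ≤ 1`). [cite: King1986, (3.12)-(3.13) p.657] -/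
theorem level_factor_le {x : ℝ} (hx : 1 < x) (mF : ℕ) {K n k i : ℕ} (hK : K = n + k) (hik : i ≤ k) {b : ℝ} (hb1 : b ≤ 1) :
    x ^ (3 * (mF + K)) * ((x ^ (k - i))⁻¹) ^ 4 * ((x ^ i)⁻¹) ^ b / x ^ (3 * i) ≤
      x ^ (3 * mF) * x ^ ((3 * n - b * k : ℝ)) := by
  have hx0 : 0 < x := by linarith
  rw [inv_pow_pow_eq_rpow hx0, inv_pow_rpow_eq_rpow hx0, ← Real.rpow_natCast x (3 * (mF + K)), ← Real.rpow_natCast x (3 * i),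
    ← Real.rpow_natCast x (3 * mF), div_eq_mul_inv, ← Real.rpow_neg hx0.le, ← Real.rpow_add hx0, ← Real.rpow_add hx0,
    ← Real.rpow_add hx0, ← Real.rpow_add hx0]
  refine Real.rpow_le_rpow_of_exponent_le hx.le ?_
  have hki : ((k - i : ℕ) : ℝ) = (k : ℝ) - i := by rw [Nat.cast_sub hik]
  have hik' : (i : ℝ) ≤ k := by exact_mod_cast hik
  have hslack : 0 ≤ (1 - b) * ((k : ℝ) - i) := mul_nonneg (by linarith) (by linarith)
  push_cast
  rw [hK, hki]
  push_cast
  nlinarith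

/-! ## §3 The per-level and total budgets -/

/-- **ONE LEVEL**: for `n ≤ K`, `j < K − n`, `0 ≤ M₀`, `b ≤ 1`,
`Σ_{Y ∈ Loc K (K−n) h (1+j)} M₀·e^{−κ₁𝓛(Y)}·((L^{K−n−1−j})⁻¹)^4·((L^{1+j})⁻¹)^b ≤ 8M₀·max(C′,0)·L^{3m_F}·L^{3n − b(K−n)}`. [cite: King1986, (3.12)-(3.13) p.657] -/
theorem level_budget_le {κ₁ C' : ℝ} (hLC : LocCover D κ₁ C') (hBV : LocBlockVolume D) {M₀ b : ℝ} (hM : 0 ≤ M₀) (hb1 : b ≤ 1)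
    {K n : ℕ} (hn : n ≤ K) (h : D.Hist K (K - n)) {j : ℕ} (hj : j < K - n) :
    ∑ Y ∈ D.Loc K (K - n) h (1 + j), M₀ * Real.exp (-κ₁ * D.treeLen K (1 + j) Y) * (((F.L : ℝ) ^ (K - n - 1 - j))⁻¹) ^ 4 *
        (((F.L : ℝ) ^ (1 + j))⁻¹) ^ b ≤
      8 * M₀ * max C' 0 * (F.L : ℝ) ^ (3 * F.m) * (F.L : ℝ) ^ ((3 * n - b * (K - n : ℕ) : ℝ)) := by
  have hL : (1 : ℝ) < (F.L : ℝ) := by exact_mod_cast F.hL.2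
  have hL0 : (0 : ℝ) < (F.L : ℝ) := by linarith
  have hki : K - n - 1 - j = (K - n) - (1 + j) := by omega
  have hfac : ∀ Y, M₀ * Real.exp (-κ₁ * D.treeLen K (1 + j) Y) * (((F.L : ℝ) ^ (K - n - 1 - j))⁻¹) ^ 4 * (((F.L : ℝ) ^ (1 + j))⁻¹) ^ b =
      (M₀ * (((F.L : ℝ) ^ (K - n - 1 - j))⁻¹) ^ 4 * (((F.L : ℝ) ^ (1 + j))⁻¹) ^ b) * Real.exp (-κ₁ * D.treeLen K (1 + j) Y) :=
    fun Y => by ring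
  simp_rw [hfac]
  rw [← Finset.mul_sum]
  have hcoef : 0 ≤ M₀ * (((F.L : ℝ) ^ (K - n - 1 - j))⁻¹) ^ 4 * (((F.L : ℝ) ^ (1 + j))⁻¹) ^ b := by positivity
  refine (mul_le_mul_of_nonneg_left (sum_exp_le D hLC hBV K (K - n) h (1 + j)) hcoef).trans ?_
  have hlev := level_factor_le hL F.m (K := K) (n := n) (k := K - n) (i := 1 + j) (by omega) (by omega) hb1
  rw [hki]
  have hC : 0 ≤ max C' 0 := le_max_right _ _
  calc M₀ * (((F.L : ℝ) ^ (K - n - (1 + j)))⁻¹) ^ 4 * (((F.L : ℝ) ^ (1 + j))⁻¹) ^ b *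
        (max C' 0 * 8 * (F.L : ℝ) ^ (3 * (F.m + K)) / (F.L : ℝ) ^ (3 * (1 + j)))
      = 8 * M₀ * max C' 0 * ((F.L : ℝ) ^ (3 * (F.m + K)) * (((F.L : ℝ) ^ (K - n - (1 + j)))⁻¹) ^ 4 *
          (((F.L : ℝ) ^ (1 + j))⁻¹) ^ b / (F.L : ℝ) ^ (3 * (1 + j))) := by ring
    _ ≤ 8 * M₀ * max C' 0 * ((F.L : ℝ) ^ (3 * F.m) * (F.L : ℝ) ^ ((3 * n - b * (K - n : ℕ) : ℝ))) :=
        mul_le_mul_of_nonneg_left hlev (by positivity)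
    _ = _ := by ring

/-- **ALL MATCHED LEVELS**: the sum over `j < K − n` of the level budgets is at most `(K−n)·8M₀·max(C′,0)·L^{3m_F}·L^{3n−b(K−n)}`. [cite: King1986, (3.12)-(3.13) p.657] -/
theorem matched_budget_le {κ₁ C' : ℝ} (hLC : LocCover D κ₁ C') (hBV : LocBlockVolume D) {M₀ b : ℝ} (hM : 0 ≤ M₀) (hb1 : b ≤ 1)
    {K n : ℕ} (hn : n ≤ K) (h : D.Hist K (K - n)) :
    ∑ j ∈ Finset.range (K - n), ∑ Y ∈ D.Loc K (K - n) h (1 + j),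
        M₀ * Real.exp (-κ₁ * D.treeLen K (1 + j) Y) * (((F.L : ℝ) ^ (K - n - 1 - j))⁻¹) ^ 4 * (((F.L : ℝ) ^ (1 + j))⁻¹) ^ b ≤
      (K - n : ℕ) * (8 * M₀ * max C' 0 * (F.L : ℝ) ^ (3 * F.m) * (F.L : ℝ) ^ ((3 * n - b * (K - n : ℕ) : ℝ))) := by
  have h1 : ∀ j ∈ Finset.range (K - n), ∑ Y ∈ D.Loc K (K - n) h (1 + j),
      M₀ * Real.exp (-κ₁ * D.treeLen K (1 + j) Y) * (((F.L : ℝ) ^ (K - n - 1 - j))⁻¹) ^ 4 * (((F.L : ℝ) ^ (1 + j))⁻¹) ^ b ≤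
      8 * M₀ * max C' 0 * (F.L : ℝ) ^ (3 * F.m) * (F.L : ℝ) ^ ((3 * n - b * (K - n : ℕ) : ℝ)) :=
    fun j hj => level_budget_le D hLC hBV hM hb1 hn h (Finset.mem_range.mp hj)
  refine (Finset.sum_le_card_nsmul _ _ _ h1).trans ?_
  rw [Finset.card_range, nsmul_eq_mul]

/-- **THE EXTRA FINEST SLICE**: `Σ_{Y ∈ Loc (K+1) (K+1−n) h 1} C·e^{−κ₁𝓛(Y)}·Θ²·((L^{K−n})⁻¹)^4 ≤ 8C·max(C′,0)·Θ²·L^{3m_F}·L^{3n − b(K−n)}` for `n ≤ K`,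
`0 ≤ C`, `b ≤ 1` (size IS a rate for the unmatched slice). [cite: Balaban1985UV3, (44)-(46) p.267] -/
theorem extra_budget_le {κ₁ C' : ℝ} (hLC : LocCover D κ₁ C') (hBV : LocBlockVolume D) {C Θ b : ℝ} (hC : 0 ≤ C) (hb1 : b ≤ 1)
    {K n : ℕ} (hn : n ≤ K) (h : D.Hist (K + 1) (K + 1 - n)) :
    ∑ Y ∈ D.Loc (K + 1) (K + 1 - n) h 1, C * Real.exp (-κ₁ * D.treeLen (K + 1) 1 Y) * Θ ^ 2 * (((F.L : ℝ) ^ (K - n))⁻¹) ^ 4 ≤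
      8 * C * max C' 0 * Θ ^ 2 * (F.L : ℝ) ^ (3 * F.m) * (F.L : ℝ) ^ ((3 * n - b * (K - n : ℕ) : ℝ)) := by
  have hL : (1 : ℝ) < (F.L : ℝ) := by exact_mod_cast F.hL.2
  have hL0 : (0 : ℝ) < (F.L : ℝ) := by linarith
  have hfac : ∀ Y, C * Real.exp (-κ₁ * D.treeLen (K + 1) 1 Y) * Θ ^ 2 * (((F.L : ℝ) ^ (K - n))⁻¹) ^ 4 =
      (C * Θ ^ 2 * (((F.L : ℝ) ^ (K - n))⁻¹) ^ 4) * Real.exp (-κ₁ * D.treeLen (K + 1) 1 Y) := fun Y => by ring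
  simp_rw [hfac]
  rw [← Finset.mul_sum]
  have hcoef : 0 ≤ C * Θ ^ 2 * (((F.L : ℝ) ^ (K - n))⁻¹) ^ 4 := by positivity
  refine (mul_le_mul_of_nonneg_left (sum_exp_le D hLC hBV (K + 1) (K + 1 - n) h 1) hcoef).trans ?_
  -- the exponent: 3(m_F + K + 1) − 4(K−n) − 3 ≤ 3m_F + 3n − b(K−n)
  have hlev : (F.L : ℝ) ^ (3 * (F.m + (K + 1))) * (((F.L : ℝ) ^ (K - n))⁻¹) ^ 4 / (F.L : ℝ) ^ (3 * 1) ≤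
      (F.L : ℝ) ^ (3 * F.m) * (F.L : ℝ) ^ ((3 * n - b * (K - n : ℕ) : ℝ)) := by
    rw [inv_pow_pow_eq_rpow hL0, ← Real.rpow_natCast (F.L : ℝ) (3 * (F.m + (K + 1))), ← Real.rpow_natCast (F.L : ℝ) (3 * 1),
      ← Real.rpow_natCast (F.L : ℝ) (3 * F.m), div_eq_mul_inv, ← Real.rpow_neg hL0.le, ← Real.rpow_add hL0, ← Real.rpow_add hL0,
      ← Real.rpow_add hL0]
    refine Real.rpow_le_rpow_of_exponent_le hL.le ?_
    have hKn : ((K - n : ℕ) : ℝ) = (K : ℝ) - n := by rw [Nat.cast_sub hn]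
    have hn' : (n : ℝ) ≤ K := by exact_mod_cast hn
    have hslack : 0 ≤ (1 - b) * ((K : ℝ) - n) := mul_nonneg (by linarith) (by linarith)
    push_cast
    rw [hKn]
    nlinarith
  calc C * Θ ^ 2 * (((F.L : ℝ) ^ (K - n))⁻¹) ^ 4 * (max C' 0 * 8 * (F.L : ℝ) ^ (3 * (F.m + (K + 1))) / (F.L : ℝ) ^ (3 * 1))
      = 8 * C * max C' 0 * Θ ^ 2 * ((F.L : ℝ) ^ (3 * (F.m + (K + 1))) * (((F.L : ℝ) ^ (K - n))⁻¹) ^ 4 / (F.L : ℝ) ^ (3 * 1)) := by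
        ring
    _ ≤ 8 * C * max C' 0 * Θ ^ 2 * ((F.L : ℝ) ^ (3 * F.m) * (F.L : ℝ) ^ ((3 * n - b * (K - n : ℕ) : ℝ))) :=
        mul_le_mul_of_nonneg_left hlev (by positivity)
    _ = _ := by ring

/-! ## §4 Along the free fraction `n = ⌊K/m⌋`: geometric decay and summability of the majorant -/

/-- **THE FREE-FRACTION EXPONENT**: with `n = ⌊K/m⌋`, `0 < m`, `0 ≤ b`: `3n − b(K − n) ≤ −(b − (3+b)/m)·K`. [cite: King1986, (3.12)-(3.13) p.657] -/
theorem exponent_le {b : ℝ} (hb : 0 ≤ b) {m : ℕ} (hm : 0 < m) (K : ℕ) :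
    (3 * (K / m : ℕ) - b * (K - K / m : ℕ) : ℝ) ≤ -(b - (3 + b) / m) * K := by
  have hdiv : ((K / m : ℕ) : ℝ) ≤ (K : ℝ) / m := Nat.cast_div_le
  have hle : K / m ≤ K := Nat.div_le_self K m
  have hsub : ((K - K / m : ℕ) : ℝ) = (K : ℝ) - (K / m : ℕ) := by rw [Nat.cast_sub hle]
  rw [hsub]
  have hm' : (0 : ℝ) < m := by exact_mod_cast hm
  have h1 : b * ((K / m : ℕ) : ℝ) ≤ b * ((K : ℝ) / m) := mul_le_mul_of_nonneg_left hdiv hb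
  have h2 : -(b - (3 + b) / m) * (K : ℝ) = 3 * ((K : ℝ) / m) - b * K + b * ((K : ℝ) / m) := by
    field_simp
    ring
  rw [h2]
  linarith

/-- **GEOMETRIC DECAY**: for `1 < L`, `0 ≤ b`, `0 < m` and `c = b − (3+b)/m`, `L^{3⌊K/m⌋ − b(K − ⌊K/m⌋)} ≤ (L^{−c})^K`. [cite: King1986, (3.12)-(3.13) p.657] -/
theorem rpow_free_fraction_le {x : ℝ} (hx : 1 < x) {b : ℝ} (hb : 0 ≤ b) {m : ℕ} (hm : 0 < m) (K : ℕ) :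
    x ^ ((3 * (K / m : ℕ) - b * (K - K / m : ℕ) : ℝ)) ≤ (x ^ (-(b - (3 + b) / m))) ^ K := by
  have hx0 : 0 < x := by linarith
  rw [← Real.rpow_natCast, ← Real.rpow_mul hx0.le]
  exact Real.rpow_le_rpow_of_exponent_le hx.le (by have := exponent_le hb hm K; linarith)

/-- **SUMMABILITY OF THE MAJORANT**: `K ↦ M·(K+1)·rᴷ` is summable for `0 ≤ r < 1`. [folklore] -/
theorem summable_majorant (M : ℝ) {r : ℝ} (hr0 : 0 ≤ r) (hr1 : r < 1) : Summable fun K : ℕ => M * ((K : ℝ) + 1) * r ^ K := by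
  have hnorm : ‖r‖ < 1 := by rw [Real.norm_eq_abs, abs_of_nonneg hr0]; exact hr1
  have h1 : Summable fun K : ℕ => ((K : ℝ) ^ 1 : ℝ) * r ^ K := summable_pow_mul_geometric_of_norm_lt_one 1 hnorm
  have h2 : Summable fun K : ℕ => r ^ K := summable_geometric_of_lt_one hr0 hr1
  have h3 : Summable fun K : ℕ => ((K : ℝ) + 1) * r ^ K := by
    have := h1.add h2
    refine this.congr fun K => ?_
    ring
  simpa [mul_assoc] using h3.mul_left M

/-- `0 < L^{−c} < 1` for `1 < L`, `0 < c` (the ratio of the majorant). [folklore] -/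
theorem rpow_neg_lt_one {x : ℝ} (hx : 1 < x) {c : ℝ} (hc : 0 < c) : 0 < x ^ (-c) ∧ x ^ (-c) < 1 :=
  ⟨Real.rpow_pos_of_pos (by linarith) _, Real.rpow_lt_one_of_one_lt_of_neg hx (by linarith)⟩

end Summit.QuantumFields.YangMills.Theorems.LogComparisonPolymerBudget

end
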